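import Summits.QuantumFields.YangMills.Theorems.UnitScaleTiltProp7SPrintDefs
import Summits.QuantumFields.YangMills.Theorems.UnitScaleTiltProp8IterPlaqSmallAllL
import Summits.QuantumFields.YangMills.Theorems.UnitScaleTiltProp7AxialSpace18Print
import Literature.MathematicalPhysics.QuantumFieldTheory.Balaban1983to89.B7Eq47AveragedBondVsStraight
import HarnessLib

/-!
# Route `UnitScaleTilt`, crux K1 child «MinimiserStabilityRegPr» (stmt-QuantumFields-19200), registered stub `stub_prop7From14` (skeleton birth_v7
# cc37a178…; leaf V3), pillar P-V3-A′ — **BOTH AVERAGINGS AGAINST THE STRAIGHT TRANSPORTER BETWEEN THE `k`-CENTRES** (engine of row (C135) of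
# `Prop7SPrintProp2.prop2Printed_sPrint_of_thm2Based`): the [Balaban1985Averaging] (43) average `avgIter` of the pullback based at the `k`-centre
# `x₀` ([Balaban1985Averaging] (24) ∕ Prop. 1, tree `B7Eq47AveragedBondVsStraight`) and the family's (0.4)-descent (p2's transport comparison with the
# base point PINNED to `embIter k y`, fed by p1 g18's all-`L` multi-level plaquette smallness), on small fields, every `L`

Cell `ym3-torus` ∕ width seat `ym-ust-19200-w1` (gen 0; D-0149; HUMAN RULING D-0037 — YM₃ on T³ is ladder rung R3, not the Clay problem).  WHY.
Print applies [6] Thm 2 with «α₁ = C₁ε₁» (p. 280), reading its hypothesis (1.35) «|(U′U₀)‾ʲ − Ū₀ʲ| < α₁ on Λ_j» off (14) «|Ū₀ʲ − V| < C₁ε₁» and (18)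
«U ∈ 𝔅_k(𝔅_k, V)», all in ONE averaging.  At the T³ carrier (14) ∕ (18) are typed in the family's (0.4)-descent (`T3TiltDescent.descendTo`, blocks
`blockOf`, contours from the CENTRES `embIter k y`), while print's letters of `S_print` (RULING g23-№3 (α)) are the `ℤᵈ` lane's on the pullback based at
`x₀ = embIter k 0` — whose (43) averages `avgIter` run over the boxes `x₀ + Lᵏz + [0, Lᵏ)ᵈ`, CORNER-anchored at the centres, half a block off the
`blockOf` partition (CARD-19200-V3-g8 §1(c)).  The two `k`-fold averages of one small-field configuration are NOT equal; but both produce bond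
variables between the SAME pairs of `k`-centres and each is within `O(α₀)` of the straight fine transporter between them.  This file proves the two
comparisons and the dictionary; the next file (`…Prop7SPrintCond135`) assembles row (C135) and P-V3-A′ from [6] Thm 2 alone.

WHAT IS PROVED (sorry-free, no definition).
§1 words: `flatMap_replicate_replicate`, `iterate_flatMap_replicate_single` (the `i`-fold straight refinement of one coarse step is `replicate Lⁱ`),
   `holAt_walk_single`; **`dist1_holAt_iter_mul_inv_le_embIter`** — p2's `IterPlaqSmall.dist1_holAt_iter_mul_inv_le` with the fine base point DISPLAYED as
   the iterated centre `embIter i y` (same induction).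
§2 **`dist1_iter_mul_inv_straight_le`** (T³, every `L`): for `U` with plaquettes `ε₀L^{−2(K−n)}`-small (`PlaqSmall (regThreshold …)`) and `10⁷L³ε₀ ≤ 1`,
   `dist1((Ū^{(k)})(y, κ)·U(straight Lᵏ-walk from embIter k y)⁻¹) ≤ (21/20)((5L)²/4)(10800L + 1)·ε₀` (correction factors from
   `IterPlaqSmallAllL.plaqSmall_iter_T3_allL` + `LatticeWordStokes.dist1_holAt_le` + `dist1_corr_le_of_loopHol`; `κ_i = τ_i` geometric, a super-solution
   since `1 + L ≤ L²`).
§3 **`norm_avgIter_pull_sub_straight_le`** (T³): for `W ∈ 𝔘_k(a)` (`RegPr`), `C₀(3)·2a ≤ ⅓`, `4a ≤ c₂′(3, L)`: the (43) average of the based pullback at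
   `(z, κ)` is within `256·4·7·2a` of the straight transporter (`norm_avgIter_sub_straight_le` at `j = k`; `pdev_pull_lt`, `avgClosed_specialUnitary_of_le_twentyone`).
§4 dictionary: `coe_hol_pull_replicate` (the `ℤᵈ` straight transport of the based pullback IS the torus straight transport, as matrices),
   `norm_coe_sub_coe_eq_dist1` (`‖A − B‖ = dist1(AB⁻¹)` on `SU(2)`), `pull_bgUnits_pert_mul` (`U′♯·U₀♯ = U♯`), `norm_iter_sub_iter_lt` ((14) + (18) ⟹ the
   family's `k`-fold averages of `U` and `U₀` are `b`-close bondwise, through `fieldShift`).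

HONEST SCOPE.  Small-field bookkeeping on the tree's certified (43) ∕ (0.4) estimates; no claim of Bałaban's beyond them; constants generous.
Count-neutral helper toward stmt-QuantumFields-19200 (`--supports`), not a proof of the stub; nothing continuum ∕ OS ∕ mass-gap ∕ Clay.

References: T. Bałaban, CMP **102** (1985) 277–309 [Balaban1985Variational] ((2) p.278, (14)–(18) p.280, (146) p.301); CMP **99** (1985) 75–102
[Balaban1985RegularSpaces] ((1.35) p.82); CMP **98** (1985) 17–51 [Balaban1985Averaging] ((9) p.18, (19)–(24) p.21, (42)–(43) pp.23–24, Prop. 1 (51)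
p.26, Prop. 2 (52)–(54) p.26); [Balaban1987RG1] (0.3)–(0.4), (0.11) pp.252–253.
-/

noncomputable section

namespace Summit.QuantumFields.YangMills.Theorems.Prop7SPrintStraight

open scoped Matrix.Norms.L2Operator BigOperators
open NormedSpace
open Literature.MathematicalPhysics.QuantumFieldTheory.Balaban1983to89
open Literature.MathematicalPhysics.QuantumFieldTheory.Balaban1983to89.T3ContinuumYM3Torus
open Literature.MathematicalPhysics.QuantumFieldTheory.Balaban1983to89.T3UnitLawDensityEML (ℰp)
open Literature.MathematicalPhysics.QuantumFieldTheory.Balaban1983to89.T3PrintedRegularMinimiser (RegPr regFibrePr mem_regFibrePr_iff)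
open Literature.MathematicalPhysics.QuantumFieldTheory.Balaban1983to89.T3RegularMinimiser (regThreshold)
open Literature.MathematicalPhysics.QuantumFieldTheory.Balaban1983to89.T3ConstrainedMinimiser (fibre)
open Literature.MathematicalPhysics.QuantumFieldTheory.Balaban1983to89.T3TiltDescent (descendTo)
open Literature.MathematicalPhysics.QuantumFieldTheory.Balaban1983to89.T3LevelShift (bondShift fieldShift fieldShift_apply)
open T4Continuum BlockAveraging ExpMeanLog LatticeWordStokes
open B7Prop1Explicit renaming Site → LSite
open B7Prop1Explicit (e hol seg seg_natCast)
open B7Prop2Explicit (avgIter pdev C0 c2' C0_pos c2'_pos AvgClosed)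
open B7AvgClosedSpecialUnitarySharp (avgClosed_specialUnitary_of_le_twentyone)
open B7Eq47AveragedBondVsStraight (norm_avgIter_sub_straight_le)
open B8Thm2TorusAt (Cond135T)
open B15DeterminingSets (embIter)
open B10Eq27TorusAxialLog (transl pull pull_apply hol_pull holT holT_eq_holAt holT_toUField val_holT_unitsField unitsField val_unitsField
  toUField val_suIncl)
open B11 (Prop2Printed)
open T3Thm1Carrier
open T3SectALandauChart (ResidFam famLG3 pert emb15 eta bgUnits CloseAvg pos_of_regPr)
open Summit.QuantumFields.YangMills.Theorems.Prop7SPrint (basePt IsAxialPrint RestrictedPrint sPrint)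
open Summit.QuantumFields.YangMills.Theorems.Prop7AxialReprPrint (pdev_pull_lt inAk_pull_of_regPr pull_toUField_mem)
open Summit.QuantumFields.YangMills.Theorems.Prop7AxialSpace18Print (transl_embIter_zero_smul)
open Summit.QuantumFields.YangMills.Theorems.IterPlaqSmall (dist1_holAt_avgFun_mul_inv_le iter_succ_eq length_flatMap_replicate
  dist1_corr_le_of_loopHol one_div_fifty_lt_deltaSU_fin_two)
open Summit.QuantumFields.YangMills.Theorems.IterPlaqSmallAllL (plaqSmall_iter_T3_allL)

/-! ## §1 Words, and the (0.4)-descent against straight transporters with the base point displayed -/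

section Words

variable {d : ℕ}

/-- Refining a straight word: `(replicate m l).flatMap (replicate L) = replicate (m·L) l`. [folklore] -/
theorem flatMap_replicate_replicate (L : ℕ) (l : Letter d) : ∀ m : ℕ,
    (List.replicate m l).flatMap (fun l' => List.replicate L l') = List.replicate (m * L) l
  | 0 => by simp
  | m + 1 => by
    rw [List.replicate_succ, List.flatMap_cons, flatMap_replicate_replicate L l m, ← List.replicate_add]
    congr 1; ring

/-- The `i`-fold straight refinement of ONE coarse step `+e_κ` is the straight fine word of `Lⁱ` steps ([Balaban1987RG1] p. 252: a coarse bond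
between block centres refines to the straight fine walk between them). [cite: Balaban1987RG1, (0.3) p.252] -/
theorem iterate_flatMap_replicate_single (L : ℕ) (κ : Fin d) : ∀ i : ℕ,
    (fun w : List (Letter d) => w.flatMap (fun l => List.replicate L l))^[i] [(κ, true)] = List.replicate (L ^ i) (κ, true)
  | 0 => by simp
  | i + 1 => by
    rw [Function.iterate_succ_apply', iterate_flatMap_replicate_single L κ i, flatMap_replicate_replicate, pow_succ]

end Words

section Transport

variable {P : Params} {j : ℕ} {G : Type*} [GaugeGroup G]

/-- The holonomy of the one-step walk `+e_κ` from `y` is the bond variable `V(y, κ)`. [folklore] -/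
theorem holAt_walk_single (V : GaugeField P j G) (y : Site P j) (κ : Fin P.d) :
    holAt V (walk y [(κ, true)]) = V ⟨y, κ⟩ := by
  simp [walk, holAt]

/-- **`i` STEPS OF THE (0.4)-DESCENT AGAINST STRAIGHT TRANSPORTERS, BASE POINT DISPLAYED** (`IterPlaqSmall.dist1_holAt_iter_mul_inv_le` with its
`∃ x` pinned): if for every level `i′ < k` every correction factor of the `(i′+1)`-st average is within `κ_{i′}` of `1`, and `τ` is a
super-solution (`0 ≤ τ₀`, `κ_i + L·τ_i ≤ τ_{i+1}`), then for `i ≤ k` and every level-`i` walk `w` from `y`,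
`dist1(Ū^{(i)}(w)·U(refineⁱ w from embIter i y)⁻¹) ≤ |w|·τ_i` — the fine walk starts at the iterated block CENTRE `embIter i y`.
[cite: Balaban1987RG1, (0.4) and (0.11) p.253; Balaban1985Averaging, (19)-(20) p.21] -/
theorem dist1_holAt_iter_mul_inv_le_embIter (ℰ : LoopAverage G) (U : GaugeField P 0 G) (k : ℕ) {κ τ : ℕ → ℝ} (hκ0 : ∀ i, 0 ≤ κ i)
    (hτ0 : 0 ≤ τ 0) (hτ : ∀ i, κ i + (P.L : ℝ) * τ i ≤ τ (i + 1))
    (hκ : ∀ i, i < k → ∀ c : PBond P (i + 1), dist1 (corr ℰ (Averaging.iter (fun j => blockAvg (P := P) (j := j) ℰ) i U) c) ≤ κ i) :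
    ∀ i, i ≤ k → ∀ (w : List (Letter P.d)) (y : Site P i),
      dist1 (holAt (Averaging.iter (fun j => blockAvg (P := P) (j := j) ℰ) i U) (walk y w) *
        (holAt U (walk (embIter i y) ((fun w : List (Letter P.d) => w.flatMap (fun l => List.replicate P.L l))^[i] w)))⁻¹) ≤
          w.length * τ i
  | 0, _, w, y => by
    simp only [Function.iterate_zero, id_eq]
    show dist1 (holAt U (walk y w) * (holAt U (walk y w))⁻¹) ≤ w.length * τ 0
    rw [mul_inv_cancel, GaugeGroup.dist1_one]
    positivity
  | i + 1, hi, w, y => by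
    have hik : i < k := Nat.lt_of_succ_le hi
    have h1 := dist1_holAt_avgFun_mul_inv_le ℰ (Averaging.iter (fun j => blockAvg (P := P) (j := j) ℰ) i U) (hκ0 i) (hκ i hik) w y
    have h2 := dist1_holAt_iter_mul_inv_le_embIter ℰ U k hκ0 hτ0 hτ hκ i hik.le (w.flatMap (fun l => List.replicate P.L l)) (emb y)
    rw [iter_succ_eq, Function.iterate_succ_apply]
    refine (B15.PrelimIntegrations.dist1_fluct_le _ _ _).trans ((add_le_add h1 h2).trans ?_)
    rw [length_flatMap_replicate, Nat.cast_mul]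
    have hlen : (0 : ℝ) ≤ w.length := Nat.cast_nonneg _
    have := hτ i
    nlinarith [mul_le_mul_of_nonneg_left this hlen]

end Transport

/-! ## §2 At the d = 3 carrier, every `L`: the family's `k`-fold averages against the straight transporters between the `k`-centres -/

section T3Descent

variable (F : T3Family) (n K : ℕ)

/-- **THE FAMILY'S `k`-FOLD (0.4)-AVERAGE OF A SMALL FIELD IS WITHIN `O(ε₀)` OF THE STRAIGHT TRANSPORTER BETWEEN THE CENTRES** (every `L`): for
`U` with plaquettes within `ε₀L^{−2(K−n)}` of `1` (the plaquette clause of (2)), `0 < ε₀`, `10⁷L³ε₀ ≤ 1`, every level-`k` site `y` and direction `κ`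
(`k = K − n`): `dist1((Ū^{(k)})(y, κ)·U(Γ)⁻¹) ≤ (21/20)((5L)²/4)(10800L+1)·ε₀`, `Γ` the straight walk of `Lᵏ` fine steps from the `k`-centre
`embIter k y`.  Per-level correction factors from p1 g18's all-`L` plaquette smallness of the iterates (`plaqSmall_iter_T3_allL`), the Stokes
bound for the (0.4) loop words at their own level (`LatticeWordStokes.dist1_holAt_le`) and `dist1_corr_le_of_loopHol`; `κ_i = τ_i` geometric
(`L^{2i}`), a super-solution because `1 + L ≤ L²`. [cite: Balaban1985Variational, (2) p.278, (146) p.301; Balaban1987RG1, (0.4) p.253; Balaban1985Averaging, (24) p.21] -/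
theorem dist1_iter_mul_inv_straight_le {ε₀ : ℝ} (hε₀ : 0 < ε₀) (hε : 10 ^ 7 * (F.L : ℝ) ^ 3 * ε₀ ≤ 1)
    (U : GaugeField (F.P K) 0 (Matrix.specialUnitaryGroup (Fin 2) ℂ)) (hU : PlaqSmall (regThreshold F n K ε₀) U)
    (y : Site (F.P K) (K - n)) (κ : Fin (F.P K).d) :
    dist1 (Averaging.iter (fun j => blockAvg (P := F.P K) (j := j) ℰp) (K - n) U ⟨y, κ⟩ *
      (holAt U (walk (embIter (K - n) y) (List.replicate ((F.P K).L ^ (K - n)) (κ, true))))⁻¹) ≤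
        21 / 20 * (((5 * (F.L : ℝ)) ^ 2 / 4) * ((10800 * (F.L : ℝ) + 1) * ε₀)) := by
  have hd : (F.P K).d = 3 := T3Family.P_d F K
  have hLL : ((F.P K).L : ℝ) = F.L := rfl
  have hL3 : 3 ≤ F.L := by obtain ⟨a, ha⟩ := F.hL.1; have := F.hL.2; omega
  have hL3r : (3 : ℝ) ≤ F.L := by exact_mod_cast hL3
  have hL0 : (0 : ℝ) < F.L := by linarith
  have hreg0 : 0 < regThreshold F n K ε₀ := by unfold regThreshold; positivity
  have hpow : (F.L : ℝ) ^ (2 * (K - n)) * regThreshold F n K ε₀ = ε₀ := by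
    rw [regThreshold, inv_pow, mul_comm, mul_assoc, inv_mul_cancel₀ (pow_ne_zero _ hL0.ne'), mul_one]
  -- the letters: `ℓ = (d+2)L = 5L`, `t_i = (10800L+1)·L^{2i}·ε₀L^{−2k}`, `κ_i = τ_i = (21/20)(ℓ²/4)t_i`
  set ℓ : ℝ := ((((F.P K).d + 2) * (F.P K).L : ℕ) : ℝ) with hℓ_def
  have hℓ : ℓ = 5 * (F.L : ℝ) := by
    have h5 : (((F.P K).d + 2) * (F.P K).L : ℕ) = 5 * F.L := by rw [hd]; rfl
    rw [hℓ_def, h5, Nat.cast_mul, Nat.cast_ofNat]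
  set t : ℕ → ℝ := fun i => (10800 * (F.L : ℝ) + 1) * ((F.L : ℝ) ^ (2 * i) * regThreshold F n K ε₀) with ht_def
  have ht0 : ∀ i, 0 ≤ t i := fun i => by positivity
  have htk : t (K - n) = (10800 * (F.L : ℝ) + 1) * ε₀ := by simp only [ht_def]; rw [hpow]
  have htmono : ∀ i, i ≤ K - n → t i ≤ t (K - n) := by
    intro i hi
    simp only [ht_def]
    have : (F.L : ℝ) ^ (2 * i) ≤ (F.L : ℝ) ^ (2 * (K - n)) := pow_le_pow_right₀ (by linarith) (by omega)
    have h0 : 0 ≤ 10800 * (F.L : ℝ) + 1 := by positivity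
    exact mul_le_mul_of_nonneg_left (mul_le_mul_of_nonneg_right this hreg0.le) h0
  -- the smallness `(ℓ²/4)·t_k ≤ 1/50`
  have hsmall : ℓ ^ 2 / 4 * t (K - n) ≤ 1 / 50 := by
    rw [htk, hℓ]
    have hL1 : (1 : ℝ) ≤ F.L := by linarith
    have h2 : (F.L : ℝ) ^ 2 ≤ (F.L : ℝ) ^ 3 := pow_le_pow_right₀ hL1 (by norm_num)
    nlinarith [sq_nonneg (F.L : ℝ), mul_pos hL0 hε₀, pow_pos hL0 3]
  set κs : ℕ → ℝ := fun i => 21 / 20 * (ℓ ^ 2 / 4 * t i) with hκs_def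
  have hκ0 : ∀ i, 0 ≤ κs i := fun i => by positivity
  -- `κ_i + L·κ_i ≤ κ_{i+1}` (`1 + L ≤ L²`)
  have hτ : ∀ i, κs i + ((F.P K).L : ℝ) * κs i ≤ κs (i + 1) := by
    intro i
    rw [hLL]
    simp only [hκs_def, ht_def]
    have hLsq : 1 + (F.L : ℝ) ≤ (F.L : ℝ) ^ 2 := by nlinarith
    have hpow2 : (F.L : ℝ) ^ (2 * (i + 1)) = (F.L : ℝ) ^ (2 * i) * (F.L : ℝ) ^ 2 := by rw [← pow_add]; congr 1
    rw [hpow2]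
    have hA : 0 ≤ 21 / 20 * (ℓ ^ 2 / 4 * ((10800 * (F.L : ℝ) + 1) * ((F.L : ℝ) ^ (2 * i) * regThreshold F n K ε₀))) := by positivity
    nlinarith
  -- the multi-level plaquette smallness (every `L`) and the correction factors
  have hPS := plaqSmall_iter_T3_allL F n K hε₀ hε U hU
  have hcorr : ∀ i, i < K - n → ∀ c : PBond (F.P K) (i + 1),
      dist1 (corr ℰp (Averaging.iter (fun j => blockAvg (P := F.P K) (j := j) ℰp) i U) c) ≤ κs i := by
    intro i hik c
    have hPSi := hPS i hik.le
    have hloop : ∀ idx : Idx (F.P K),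
        dist1 (loopHol (Averaging.iter (fun j => blockAvg (P := F.P K) (j := j) ℰp) i U) c idx) ≤ ℓ ^ 2 / 4 * t i := by
      intro idx
      set lw := loopWord (F.P K).L c.dir (off idx.1) idx.2.1 idx.2.2 with hlw_def
      have hclosed : ∀ ν, netDisp lw ν = 0 := fun ν => by rw [hlw_def, netDisp_loopWord]
      have h := dist1_holAt_le (Averaging.iter (fun j => blockAvg (P := F.P K) (j := j) ℰp) i U) (ht0 i) hPSi lw hclosed (emb c.src)
      have hlen : (lw.length : ℝ) ≤ ℓ := by rw [hℓ_def]; exact_mod_cast length_loopWord_le c idx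
      have hlen0 : (0 : ℝ) ≤ lw.length := Nat.cast_nonneg _
      have hsq : (lw.length : ℝ) ^ 2 ≤ ℓ ^ 2 := pow_le_pow_left₀ hlen0 hlen 2
      calc dist1 (loopHol (Averaging.iter (fun j => blockAvg (P := F.P K) (j := j) ℰp) i U) c idx)
          ≤ (lw.length : ℝ) ^ 2 / 4 * t i := h
        _ ≤ ℓ ^ 2 / 4 * t i := by
          exact mul_le_mul_of_nonneg_right (by linarith) (ht0 i)
    have hti : ℓ ^ 2 / 4 * t i ≤ 1 / 50 :=
      (mul_le_mul_of_nonneg_left (htmono i hik.le) (by positivity)).trans hsmall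
    exact dist1_corr_le_of_loopHol _ c hloop hti (lt_of_le_of_lt hti one_div_fifty_lt_deltaSU_fin_two)
  -- the transport comparison at `i = k` on the one-step walk `+e_κ`
  have h := dist1_holAt_iter_mul_inv_le_embIter ℰp U (K - n) hκ0 (hκ0 0) hτ hcorr (K - n) le_rfl [(κ, true)] y
  rw [holAt_walk_single, iterate_flatMap_replicate_single, List.length_singleton, Nat.cast_one, one_mul] at h
  refine h.trans (le_of_eq ?_)
  simp only [hκs_def]
  rw [htk, hℓ]

end T3Descent

/-! ## §3 The (43) average of the based pullback against the same straight transporter -/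

section B7Side

variable (F : T3Family) {n K : ℕ}

/-- **[Balaban1985Averaging] (24) ∕ PROP. 1 FOR THE BASED PULLBACK**: for `W ∈ 𝔘_k(a)` (`RegPr`, both clauses of (2)) with `C₀(3)·2a ≤ ⅓` and
`4a ≤ c₂′(3, L)`, the `k`-fold (43) average of `W♯_{x₀}` at the level-`k` bond `(z, κ)` is within `256·4·7·(2a)` of the transporter of `W♯_{x₀}` along
the straight contour of `Lᵏ` fine bonds from `Lᵏz` (`B7Eq47AveragedBondVsStraight.norm_avgIter_sub_straight_le` at `j = k`, in the class (52) by
`Prop7AxialReprPrint.pdev_pull_lt`; `SU(2)` is averaging-closed, `avgClosed_specialUnitary_of_le_twentyone`).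
[cite: Balaban1985Averaging, (24) p.21, (43) p.24, Prop. 1 (51) p.26, Prop. 2 (52)-(54) p.26] -/
theorem norm_avgIter_pull_sub_straight_le {a : ℝ} (ha : 0 < a) (ha3 : C0 (F.P K).d * (2 * a) ≤ 1 / 3) (ha2 : 2 * (2 * a) ≤ c2' (F.P K).d (F.P K).L)
    {W : GaugeField (F.P K) 0 (Matrix.specialUnitaryGroup (Fin 2) ℂ)} (hW : RegPr F n K a W) (x₀ : Site (F.P K) 0)
    (z : LSite (F.P K).d) (κ : Fin (F.P K).d) :
    ‖((avgIter (F.P K).L (pull (bgUnits F K W) x₀) (K - n) z κ : (Matrix (Fin 2) (Fin 2) ℂ)ˣ) : Matrix (Fin 2) (Fin 2) ℂ) -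
        ((hol (pull (bgUnits F K W) x₀) (((F.P K).L : ℤ) ^ (K - n) • z) (seg κ (((F.P K).L ^ (K - n) : ℕ) : ℤ)) : (Matrix (Fin 2) (Fin 2) ℂ)ˣ) :
          Matrix (Fin 2) (Fin 2) ℂ)‖ ≤ 256 * ((F.P K).d + 1) * ((F.P K).d + 4) * (2 * a) := by
  have hL2 : 2 ≤ (F.P K).L := (F.P K).hL.2
  have hG : AvgClosed (F.P K).d (F.P K).L (B7Prop2SpecialUnitary.specialUnitaryUnits (Fin 2)) :=
    avgClosed_specialUnitary_of_le_twentyone (by norm_num) _ _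
  have hV : ∀ z' κ', pull (bgUnits F K W) x₀ z' κ' ∈ B7Prop2SpecialUnitary.specialUnitaryUnits (Fin 2) := pull_toUField_mem W x₀
  have h52 : pdev (pull (bgUnits F K W) x₀) < 2 * a * ((((F.P K).L : ℝ) ^ (K - n))⁻¹) ^ 2 :=
    pdev_pull_lt ha (inAk_pull_of_regPr F ha.le hW) x₀
  have h := norm_avgIter_sub_straight_le (F.P K).L hL2 hG (K - n) _ hV (by positivity) ha3 ha2 h52 (K - n) le_rfl z κ
  have hone : ((F.P K).L : ℝ) ^ (K - n) * (((F.P K).L : ℝ) ^ (K - n))⁻¹ = 1 :=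
    mul_inv_cancel₀ (pow_ne_zero _ (by have := (F.P K).hL.2; positivity))
  rw [hone, one_pow, mul_one] at h
  exact h

end B7Side

/-! ## §4 Dictionary: straight transports, `‖A − B‖ = dist1(AB⁻¹)`, `U′♯U₀♯ = U♯`, and (14) + (18) bondwise -/

section Dictionary

variable {P : Params} {N : ℕ}

/-- **THE `ℤᵈ` STRAIGHT TRANSPORT OF THE BASED PULLBACK IS THE TORUS STRAIGHT TRANSPORT**, as matrices: `W♯_{x₀}(seg from z) = 𝒰_{x₀ + z}(replicate m
(κ, +))(W)` (`hol_pull`, `holT_eq_holAt`, read in `M_N(ℂ)` through `unitsField ∘ toUField`). [cite: Balaban1985Averaging, (9) p.18, (19) p.21] -/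
theorem coe_hol_pull_replicate [NeZero N] (W : GaugeField P 0 (Matrix.specialUnitaryGroup (Fin N) ℂ)) (x₀ : Site P 0) (z : LSite P.d)
    (κ : Fin P.d) (m : ℕ) :
    ((hol (pull (unitsField (toUField W)) x₀) z (seg κ (m : ℤ)) : (Matrix (Fin N) (Fin N) ℂ)ˣ) : Matrix (Fin N) (Fin N) ℂ) =
      ((holAt W (walk (transl x₀ z) (List.replicate m (κ, true))) : Matrix.specialUnitaryGroup (Fin N) ℂ) : Matrix (Fin N) (Fin N) ℂ) := by
  rw [hol_pull, seg_natCast, val_holT_unitsField, holT_toUField, holT_eq_holAt, val_suIncl]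

/-- `‖A − B‖ = dist1(AB⁻¹)` for `A, B ∈ SU(2)` read in `M₂(ℂ)` (right multiplication by the unitary `B` is an isometry of the `C⋆`-norm; `dist1 W =
‖W − 1‖_op`). [cite: Balaban1985Averaging, (19)-(20) p.21] -/
theorem norm_coe_sub_coe_eq_dist1 (A B : Matrix.specialUnitaryGroup (Fin 2) ℂ) :
    ‖((A : Matrix.specialUnitaryGroup (Fin 2) ℂ) : Matrix (Fin 2) (Fin 2) ℂ) - (B : Matrix (Fin 2) (Fin 2) ℂ)‖ = dist1 (A * B⁻¹) := by
  have hd : dist1 (A * B⁻¹) = ‖((A * B⁻¹ : Matrix.specialUnitaryGroup (Fin 2) ℂ) : Matrix (Fin 2) (Fin 2) ℂ) - 1‖ := rfl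
  have hB : ((B : Matrix.specialUnitaryGroup (Fin 2) ℂ) : Matrix (Fin 2) (Fin 2) ℂ) ∈ unitary (Matrix (Fin 2) (Fin 2) ℂ) := B.2.1
  have hmul : (((A * B⁻¹ : Matrix.specialUnitaryGroup (Fin 2) ℂ) : Matrix (Fin 2) (Fin 2) ℂ) - 1) * (B : Matrix (Fin 2) (Fin 2) ℂ) =
      (A : Matrix (Fin 2) (Fin 2) ℂ) - (B : Matrix (Fin 2) (Fin 2) ℂ) := by
    rw [sub_mul, one_mul]
    congr 1
    have : ((A * B⁻¹ * B : Matrix.specialUnitaryGroup (Fin 2) ℂ) : Matrix (Fin 2) (Fin 2) ℂ) = (A : Matrix (Fin 2) (Fin 2) ℂ) := by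
      rw [inv_mul_cancel_right]
    rw [← this]
    rfl
  rw [hd, ← hmul, CStarRing.norm_mul_mem_unitary _ hB]

end Dictionary

section T3Dictionary

variable (F : T3Family) {n K : ℕ}

/-- `U′♯·U₀♯ = U♯` for `U′ = UU₀⁻¹` ((15), read in the units of `M₂(ℂ)` on the based pullbacks). [cite: Balaban1985Variational, (15) p.280] -/
theorem pull_bgUnits_pert_mul (U₀ U : GaugeField (F.P K) 0 (Matrix.specialUnitaryGroup (Fin 2) ℂ)) (x₀ : Site (F.P K) 0) :
    pull (bgUnits F K (pert U₀ U)) x₀ * pull (bgUnits F K U₀) x₀ = pull (bgUnits F K U) x₀ := by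
  funext z μ
  apply Units.ext
  show ((pert U₀ U ⟨transl x₀ z, μ⟩ : Matrix.specialUnitaryGroup (Fin 2) ℂ) : Matrix (Fin 2) (Fin 2) ℂ) *
      ((U₀ ⟨transl x₀ z, μ⟩ : Matrix.specialUnitaryGroup (Fin 2) ℂ) : Matrix (Fin 2) (Fin 2) ℂ) =
    ((U ⟨transl x₀ z, μ⟩ : Matrix.specialUnitaryGroup (Fin 2) ℂ) : Matrix (Fin 2) (Fin 2) ℂ)
  rw [← Submonoid.coe_mul, show pert U₀ U ⟨transl x₀ z, μ⟩ * U₀ ⟨transl x₀ z, μ⟩ = U ⟨transl x₀ z, μ⟩ from inv_mul_cancel_right _ _]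

/-- **(14) + (18) BONDWISE ON THE COMPARISON LATTICE**: if `|Ū₀ − V| < b` in the family's averaging (`CloseAvg`) and `U` lies in the descent fibre of `V`
(`Ū = V`), then at every level-`k` bond the `k`-fold (0.4)-averages of `U` and `U₀` are within `b` (`descendTo` = `fieldShift` of the `k`-fold iterate,
`T3TiltDescent`; the reindexing `bondShift` is a bijection). [cite: Balaban1985Variational, (14) p.280, (18) p.280; Balaban1987RG1, (0.11) p.253] -/
theorem norm_iter_sub_iter_lt (hnK : n ≤ K) {b : ℝ} {V : GaugeField (F.P n) 0 (Matrix.specialUnitaryGroup (Fin 2) ℂ)}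
    {U₀ U : GaugeField (F.P K) 0 (Matrix.specialUnitaryGroup (Fin 2) ℂ)} (hclose : CloseAvg F n K hnK b V U₀) (hfib : U ∈ fibre F ℰp n K hnK V)
    (bd : PBond (F.P K) (K - n)) :
    ‖((Averaging.iter (fun i => blockAvg (P := F.P K) (j := i) ℰp) (K - n) U bd : Matrix.specialUnitaryGroup (Fin 2) ℂ) : Matrix (Fin 2) (Fin 2) ℂ) -
        ((Averaging.iter (fun i => blockAvg (P := F.P K) (j := i) ℰp) (K - n) U₀ bd : Matrix.specialUnitaryGroup (Fin 2) ℂ) :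
          Matrix (Fin 2) (Fin 2) ℂ)‖ < b := by
  have hs : (F.PP F.m n).sitesPerDir 0 = (F.PP F.m K).sitesPerDir (K - n) := F.sitesPerDir_eq (by omega)
  have hdesc : ∀ W : GaugeField (F.P K) 0 (Matrix.specialUnitaryGroup (Fin 2) ℂ),
      descendTo F ℰp n K hnK W = fieldShift hs (Averaging.iter (fun i => blockAvg (P := F.P K) (j := i) ℰp) (K - n) W) := fun W => rfl
  have e : ∀ W : GaugeField (F.P K) 0 (Matrix.specialUnitaryGroup (Fin 2) ℂ),
      descendTo F ℰp n K hnK W ((bondShift hs).symm bd) = Averaging.iter (fun i => blockAvg (P := F.P K) (j := i) ℰp) (K - n) W bd := by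
    intro W
    rw [hdesc, fieldShift_apply, Equiv.apply_symm_apply]
  have hV : descendTo F ℰp n K hnK U = V := hfib
  have h := hclose ((bondShift hs).symm bd)
  rw [← hV, e, e] at h
  rwa [norm_sub_rev] at h

end T3Dictionary

end Summit.QuantumFields.YangMills.Theorems.Prop7SPrintStraight

end
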